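import Summits.Ventures.PercRepro.Night2ShadowHull
import Summits.Ventures.PercRepro.Night2ShadowFirstLayer

/-!
# PercRepro — the averaging identity for the direct bound, and the thin independent families (night-2, gen 5)

The PLAIN direct bound at `x` (the hull replaced by the members) is
`directPlain M q 𝒜 x = #{B ∈ 𝒜 : x ∉ cl B} + (Σ_{B ∈ 𝒜, x ∉ B} #((E ∖ cl B) ∖ {x})) / (q + 1)`; it is at most the direct-hull
bound (`directPlain_le_directHull`), hence at most the shadow.  Summed over the ground set it has an EXACT value:
`Σ_x (q + 1)·directPlain(x) = Σ_{B ∈ 𝒜} c(B)·(#E − #B + q)` with `c(B) = #(E ∖ cl B)` (`sum_directPlain`), so some `x` has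
`(q + 1)·#E·directHull(x) ≥ Σ_B c(B)·(#E − #B + q)` (`exists_directHull_ge_average`).  Consequently the selection — and with it
the shadow condition — holds for every family all of whose members satisfy `(q + 2)·#E ≤ c(B)·(#E − #B + q)`, in particular
for every family of INDEPENDENT members (`#B = q`) with `c(B) ≥ q + 2` (`shadow_card_of_thin_indep`): all families of a uniform
matroid `U_{q+2,n}`, the tight classes included.  What the selection conjecture adds is exactly the dependent and the fat
members, where the average fails and the hull is needed (`proofs/NIGHT-2-shadow.md` §12).
-/

namespace PercRepro.Shadow

open Finset PerFlat ThmH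

variable {α : Type*} [DecidableEq α] {M : Matroid α} [M.Finite]

/-- The plain direct bound at `x` (members only). -/
noncomputable def directPlain (M : Matroid α) [M.Finite] (q : ℕ) (𝒜 : Finset (Finset α)) (x : α) : ℚ :=
  ((𝒜.filter (fun B => x ∉ clF M B)).card : ℚ) +
    ((∑ B ∈ 𝒜.filter (fun B => x ∉ B), ((gr M \ clF M B).erase x).card : ℕ) : ℚ) / (q + 1)

/-- Every member lies in the hull. -/
theorem subset_hull {p q : ℕ} {𝒜 : Finset (Finset α)} (h𝒜 : 𝒜 ⊆ Uq M p q) : 𝒜 ⊆ hull M 𝒜 := by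
  intro B hB
  rw [mem_hull h𝒜]
  exact ⟨B, hB, Finset.Subset.refl _, subset_clF (h𝒜 hB)⟩

/-- The plain direct bound is at most the direct-hull bound. -/
theorem directPlain_le_directHull {q : ℕ} {𝒜 : Finset (Finset α)} (h𝒜 : 𝒜 ⊆ Uq M (q + 2) q) (x : α) :
    directPlain M q 𝒜 x ≤ directHull M q 𝒜 x := by
  unfold directPlain directHull
  have hq1 : (0 : ℚ) < (q : ℚ) + 1 := by positivity
  have h1 : (𝒜.filter (fun B => x ∉ clF M B)).card ≤ ((hull M 𝒜).filter (fun T => x ∉ clF M T)).card := by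
    apply Finset.card_le_card
    intro B hB
    rw [Finset.mem_filter] at hB ⊢
    exact ⟨subset_hull h𝒜 hB.1, hB.2⟩
  have h2 : ∑ B ∈ 𝒜.filter (fun B => x ∉ B), ((gr M \ clF M B).erase x).card ≤
      ∑ T ∈ (hull M 𝒜).filter (fun T => x ∉ T), ((gr M \ clF M T).erase x).card := by
    apply Finset.sum_le_sum_of_subset_of_nonneg
    · intro B hB
      rw [Finset.mem_filter] at hB ⊢
      exact ⟨subset_hull h𝒜 hB.1, hB.2⟩
    · intro _ _ _; exact Nat.zero_le _
  have h1' : ((𝒜.filter (fun B => x ∉ clF M B)).card : ℚ) ≤ (((hull M 𝒜).filter (fun T => x ∉ clF M T)).card : ℚ) := by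
    exact_mod_cast h1
  have h2' : ((∑ B ∈ 𝒜.filter (fun B => x ∉ B), ((gr M \ clF M B).erase x).card : ℕ) : ℚ) / (q + 1) ≤
      ((∑ T ∈ (hull M 𝒜).filter (fun T => x ∉ T), ((gr M \ clF M T).erase x).card : ℕ) : ℚ) / (q + 1) := by
    apply div_le_div_of_nonneg_right _ hq1.le
    exact_mod_cast h2
  linarith

/-- For a bottom set, `#{x ∈ E : x ∉ B} = #E − #B`. -/
theorem card_compl_member {p q : ℕ} {B : Finset α} (hB : B ∈ Uq M p q) :
    ((gr M).filter (fun x => x ∉ B)).card = (gr M).card - B.card := by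
  have h : (gr M).filter (fun x => x ∉ B) = gr M \ B := by
    ext x; simp [Finset.mem_sdiff]
  rw [h, Finset.card_sdiff_of_subset (mem_Uq.1 hB).1]

/-- **The averaging identity**: `Σ_{x ∈ E} (q + 1)·directPlain(x) = Σ_B c(B)·(#E − #B + q)`. -/
theorem sum_directPlain {p q : ℕ} {𝒜 : Finset (Finset α)} (h𝒜 : 𝒜 ⊆ Uq M p q) :
    ∑ x ∈ gr M, ((q : ℚ) + 1) * directPlain M q 𝒜 x =
      ∑ B ∈ 𝒜, ((coclosureCard M B : ℕ) : ℚ) * (((gr M).card : ℚ) - (B.card : ℚ) + q) := by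
  classical
  have hq1 : ((q : ℚ) + 1) ≠ 0 := by positivity
  -- expand directPlain and swap the sums
  have hexp : ∀ x, ((q : ℚ) + 1) * directPlain M q 𝒜 x =
      ∑ B ∈ 𝒜, ((if x ∉ clF M B then ((q : ℚ) + 1) else 0) +
        (if x ∉ B then (((gr M \ clF M B).erase x).card : ℚ) else 0)) := by
    intro x
    unfold directPlain
    rw [mul_add, mul_div_cancel₀ _ hq1, Finset.card_eq_sum_ones, Finset.sum_filter, Finset.sum_filter,
      Nat.cast_sum, Nat.cast_sum, Finset.mul_sum, ← Finset.sum_add_distrib]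
    apply Finset.sum_congr rfl
    intro B _
    split_ifs <;> simp
  simp_rw [hexp]
  rw [Finset.sum_comm]
  apply Finset.sum_congr rfl
  intro B hB
  rw [Finset.sum_add_distrib, ← Finset.sum_filter, ← Finset.sum_filter]
  -- first sum: (q+1) * c(B);  second: Σ_{x ∉ B} (c(B) − [x ∉ cl B]) = (n − #B)·c(B) − c(B)
  have hBg := (mem_Uq.1 (h𝒜 hB)).1
  have hcl : clF M B ⊆ gr M := by
    rw [← Finset.coe_subset, coe_clF, coe_gr]; exact M.closure_subset_ground _
  have hBcl : B ⊆ clF M B := subset_clF (h𝒜 hB)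
  have h1 : (gr M).filter (fun x => x ∉ clF M B) = gr M \ clF M B := by
    ext x; simp [Finset.mem_sdiff]
  have hc : ((gr M).filter (fun x => x ∉ clF M B)).card = coclosureCard M B := by
    rw [h1]; rfl
  -- the second sum
  have h2 : ∀ x ∈ (gr M).filter (fun x => x ∉ B),
      (((gr M \ clF M B).erase x).card : ℚ) = (coclosureCard M B : ℚ) - (if x ∉ clF M B then 1 else 0) := by
    intro x hx
    unfold coclosureCard
    by_cases hxc : x ∈ clF M B
    · rw [if_neg (by simpa using hxc), sub_zero, Finset.erase_eq_of_notMem]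
      simp [Finset.mem_sdiff, hxc]
    · rw [if_pos hxc, Finset.card_erase_of_mem (by rw [Finset.mem_sdiff]; exact ⟨(Finset.mem_filter.1 hx).1, hxc⟩)]
      have : 1 ≤ (gr M \ clF M B).card := Finset.card_pos.2 ⟨x, by rw [Finset.mem_sdiff]; exact ⟨(Finset.mem_filter.1 hx).1, hxc⟩⟩
      push_cast [Nat.cast_sub this]
      ring
  rw [Finset.sum_congr rfl h2, Finset.sum_sub_distrib, Finset.sum_const, ← Finset.sum_filter]
  have h3 : ((gr M).filter (fun x => x ∉ B)).filter (fun x => x ∉ clF M B) = gr M \ clF M B := by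
    ext x
    simp only [Finset.mem_filter, Finset.mem_sdiff]
    constructor
    · rintro ⟨⟨h1, -⟩, h2⟩; exact ⟨h1, h2⟩
    · rintro ⟨h1, h2⟩; exact ⟨⟨h1, fun h => h2 (hBcl h)⟩, h2⟩
  rw [h3, Finset.sum_const, card_compl_member (h𝒜 hB)]
  have hcard : B.card ≤ (gr M).card := Finset.card_le_card hBg
  simp only [Finset.sum_const, nsmul_eq_mul, mul_one]
  rw [hc]
  have hcc : (((gr M \ clF M B).card : ℕ) : ℚ) = ((coclosureCard M B : ℕ) : ℚ) := rfl
  rw [hcc]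
  push_cast [Nat.cast_sub hcard]
  ring

/-- **Some element reaches the average**: `(q + 1)·#E·directHull(x) ≥ Σ_B c(B)·(#E − #B + q)` for some `x ∈ E`
(`E` nonempty). -/
theorem exists_directHull_ge_average {q : ℕ} {𝒜 : Finset (Finset α)} (h𝒜 : 𝒜 ⊆ Uq M (q + 2) q)
    (hE : (gr M).Nonempty) :
    ∃ x ∈ gr M, ∑ B ∈ 𝒜, ((coclosureCard M B : ℕ) : ℚ) * (((gr M).card : ℚ) - (B.card : ℚ) + q) ≤
      ((gr M).card : ℚ) * (((q : ℚ) + 1) * directHull M q 𝒜 x) := by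
  classical
  -- the sum equals the sum of the plain bounds; some term is at least the average
  have hsum := sum_directPlain (M := M) (q := q) h𝒜
  have hle : ∑ x ∈ gr M, ((q : ℚ) + 1) * directPlain M q 𝒜 x ≤
      ∑ x ∈ gr M, ((q : ℚ) + 1) * directHull M q 𝒜 x := by
    apply Finset.sum_le_sum
    intro x _
    exact mul_le_mul_of_nonneg_left (directPlain_le_directHull h𝒜 x) (by positivity)
  obtain ⟨x, hx, hmax⟩ := Finset.exists_max_image (gr M) (fun x => ((q : ℚ) + 1) * directHull M q 𝒜 x) hE
  refine ⟨x, hx, ?_⟩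
  rw [← hsum]
  calc ∑ y ∈ gr M, ((q : ℚ) + 1) * directPlain M q 𝒜 y ≤ ∑ y ∈ gr M, ((q : ℚ) + 1) * directHull M q 𝒜 y := hle
    _ ≤ ∑ _y ∈ gr M, ((q : ℚ) + 1) * directHull M q 𝒜 x := Finset.sum_le_sum (fun y hy => hmax y hy)
    _ = ((gr M).card : ℚ) * (((q : ℚ) + 1) * directHull M q 𝒜 x) := by simp

/-- **The selection holds for every family whose members satisfy `(q + 2)·#E ≤ c(B)·(#E − #B + q)`**, hence so does
the shadow condition. -/
theorem shadow_card_of_member_bound {q : ℕ} {𝒜 : Finset (Finset α)} (h𝒜 : 𝒜 ⊆ Uq M (q + 2) q)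
    (hE : (gr M).Nonempty)
    (hmem : ∀ B ∈ 𝒜, ((q : ℚ) + 2) * ((gr M).card : ℚ) ≤ ((coclosureCard M B : ℕ) : ℚ) * (((gr M).card : ℚ) - (B.card : ℚ) + q)) :
    ((q + 2 : ℚ) / (q + 1)) * (𝒜.card : ℚ) ≤ ((shadow M (q + 2) q 𝒜).card : ℚ) := by
  obtain ⟨x, hx, havg⟩ := exists_directHull_ge_average h𝒜 hE
  have hsum : ((q : ℚ) + 2) * ((gr M).card : ℚ) * (𝒜.card : ℚ) ≤
      ∑ B ∈ 𝒜, ((coclosureCard M B : ℕ) : ℚ) * (((gr M).card : ℚ) - (B.card : ℚ) + q) := by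
    calc ((q : ℚ) + 2) * ((gr M).card : ℚ) * (𝒜.card : ℚ) = ∑ _B ∈ 𝒜, ((q : ℚ) + 2) * ((gr M).card : ℚ) := by simp [mul_comm]
      _ ≤ _ := Finset.sum_le_sum hmem
  have hn : (0 : ℚ) < ((gr M).card : ℚ) := by exact_mod_cast Finset.card_pos.2 hE
  have hq1 : (0 : ℚ) < (q : ℚ) + 1 := by positivity
  have hD := directHull_le_card_shadow h𝒜 hx
  have h1 : ((q : ℚ) + 2) * (𝒜.card : ℚ) ≤ ((q : ℚ) + 1) * directHull M q 𝒜 x := by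
    have := le_trans hsum havg
    nlinarith
  rw [div_mul_eq_mul_div, div_le_iff₀ hq1]
  nlinarith

/-- **Thin independent families**: if every member is independent (`#B = q`) and has `≥ q + 2` ground elements outside its
closure, the shadow condition holds (all families of a uniform matroid `U_{q+2,n}`, the tight classes included). -/
theorem shadow_card_of_thin_indep {q : ℕ} {𝒜 : Finset (Finset α)} (h𝒜 : 𝒜 ⊆ Uq M (q + 2) q)
    (hE : (gr M).Nonempty) (hind : ∀ B ∈ 𝒜, B.card = q) (hthin : ∀ B ∈ 𝒜, q + 2 ≤ coclosureCard M B) :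
    ((q + 2 : ℚ) / (q + 1)) * (𝒜.card : ℚ) ≤ ((shadow M (q + 2) q 𝒜).card : ℚ) := by
  apply shadow_card_of_member_bound h𝒜 hE
  intro B hB
  have h1 : ((q : ℚ) + 2) ≤ ((coclosureCard M B : ℕ) : ℚ) := by exact_mod_cast hthin B hB
  have h2 : (B.card : ℚ) = q := by exact_mod_cast hind B hB
  rw [h2]
  have hn : (0 : ℚ) ≤ ((gr M).card : ℚ) := by positivity
  nlinarith

end PercRepro.Shadow
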